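import Mathlib.LinearAlgebra.Lagrange
import Literature.NumberTheory.Transcendental.ChudnovskyAnalytic
import Literature.NumberTheory.Transcendental.ChudnovskyHeights
import HarnessLib

/-!
# Chudnovsky's theorem on periods — the zero estimate

Topic `Literature/NumberTheory/Transcendental` (trunk T-TRANSCEND). Node [ZE] of the proof of
`Literature.NumberTheory.Transcendental.Chudnovsky1984_thm_7_3_1` (Chudnovsky 1984, Ch. 7, Theorem 3.1).

Chudnovsky 1984, Ch. 7, Lemma 3.2 (p. 310, "we use Masser's arguments [M3]"): the number of zeros
of `F(z) = P(ζ(z) - (η/ω)z, ℘(z))`, `P ≠ 0` of degree `(L₁, L₂)`, in `|z| ≤ R` is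
`≤ γ₈ L₁²L₂ + γ₉ L₂ R²`. We prove the weaker, *elementary* estimate that suffices for Theorem 3.1:
if `F_p^{(j)}(s_m) = 0` for all `j < T`, `m < X` (`p ≠ 0` of bidegree `≤ (D, D)`), then
`T X² ≤ C (D+1) (X+D)²`. The argument (a quantitative form of the algebraic independence of
`g = ζ - κz` and `℘`, replacing Masser's): by Schwarz's lemma (`ChudnovskyAnalytic.lean`,
`norm_F_translate_le_of_zeros`) the vanishing makes `F_p` small on the translates `B + mω₂`,
`m ≤ D`, of a small disc `B` around `ω₁/2`; since `F_p(z + mω₂) = ∑ p_{ik} (g(z) + mc)ⁱ ℘(z)ᵏ`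
with `c ≠ 0`, Lagrange interpolation at the equally spaced nodes `g(z) + mc` bounds the
polynomials `∑_k p_{ik} ℘(z)ᵏ` on `B`, and a second interpolation at nodes `℘(z_r) = e₁ + r h`
(available by the open mapping theorem) bounds the coefficients `p_{ik}` themselves by
`‖p‖ · exp(C'(D+1)(X+D)²) · exp(-T X²)`; comparing with `‖p‖ ≠ 0` gives the claim.

## Contents (no definitions)

* `interpolation_bound` — coefficients of a polynomial of degree `≤ n` are bounded by
  `(n+1) ((1 + |u₀| + n|c|)/|c|)ⁿ` times its maximum on the nodes `u₀ + mc`, `m = 0, …, n`.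
* `zero_estimate` — the statement above.
-/

noncomputable section

open Complex Metric Finset Polynomial
open scoped PeriodPair

namespace Literature.NumberTheory.Transcendental.Chudnovsky

/-! ### Lagrange interpolation at equally spaced nodes -/

/-- The `ℓ¹`-norm of a Lagrange basis divisor: `‖C (x-y)⁻¹ (X - C y)‖₁ ≤ |x-y|⁻¹ (1 + |y|)`.
[folklore] -/
lemma pwnorm_basisDivisor_le (x y : ℂ) :
    pwnorm (normRingSeminorm ℂ) (Lagrange.basisDivisor x y) ≤ ‖(x - y)⁻¹‖ * (1 + ‖y‖) := by
  unfold Lagrange.basisDivisor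
  refine (pwnorm_mul_le _ _ _).trans ?_
  rw [pwnorm_C]
  refine mul_le_mul_of_nonneg_left ((pwnorm_X_sub_C_le _ y).trans (le_of_eq ?_)) (apply_nonneg _ _)
  change ‖(1 : ℂ)‖ + ‖y‖ = 1 + ‖y‖
  rw [norm_one]

/-- **Interpolation bound at equally spaced nodes.** If `q(u) = ∑_{j ≤ n} a_j u^j` satisfies
`|q(u₀ + mc)| ≤ V` for `m = 0, …, n` (`c ≠ 0`), then every coefficient satisfies
`|a_j| ≤ (n+1) ((1 + |u₀| + n|c|)/|c|)ⁿ V` (Lagrange's formula: the basis polynomials have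
`ℓ¹`-norm `≤ ∏_{m' ≠ m} (1 + |u₀ + m'c|)/|u_m - u_{m'}|` and `|u_m - u_{m'}| ≥ |c|`). [folklore] -/
theorem interpolation_bound (n : ℕ) (a : Fin (n + 1) → ℂ) (u₀ c : ℂ) (hc : c ≠ 0) {V : ℝ}
    (hV : 0 ≤ V)
    (h : ∀ m : ℕ, m ≤ n → ‖∑ j : Fin (n + 1), a j * (u₀ + m * c) ^ (j : ℕ)‖ ≤ V) (j : Fin (n + 1)) :
    ‖a j‖ ≤ (n + 1) * ((1 + ‖u₀‖ + n * ‖c‖) / ‖c‖) ^ n * V := by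
  classical
  set q : ℂ[X] := ∑ j : Fin (n + 1), Polynomial.monomial (j : ℕ) (a j) with hq
  set v : Fin (n + 1) → ℂ := fun m => u₀ + (m : ℕ) * c with hv
  have hvinj : Set.InjOn v (Finset.univ : Finset (Fin (n + 1))) := by
    intro m _ m' _ hmm
    simp only [hv] at hmm
    have : ((m : ℕ) : ℂ) = ((m' : ℕ) : ℂ) := by
      have h1 := mul_right_cancel₀ hc (add_left_cancel hmm)
      exact h1
    exact Fin.ext (by exact_mod_cast this)
  have hqdeg : q.degree < (Finset.univ : Finset (Fin (n + 1))).card := by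
    rw [Finset.card_univ, Fintype.card_fin, hq]
    have : q = ∑ j : Fin (n + 1), C (a j) * X ^ (j : ℕ) := by
      simp only [hq, Polynomial.C_mul_X_pow_eq_monomial]
    rw [← hq, this]
    exact Polynomial.degree_sum_fin_lt a
  have hqeval : ∀ m : Fin (n + 1), q.eval (v m) = ∑ j : Fin (n + 1), a j * (u₀ + (m : ℕ) * c) ^ (j : ℕ) := by
    intro m
    simp only [hq, hv, Polynomial.eval_finsetSum, Polynomial.eval_monomial]
  have hinterp := Lagrange.eq_interpolate hvinj hqdeg
  -- the coefficient `a j` is the `j`-th coefficient of `q`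
  have hcoeff : a j = q.coeff j := by
    rw [hq, coeff_sum_monomial_fin, dif_pos j.2]
  -- `ℓ¹`-norm of the Lagrange basis polynomials
  set K : ℝ := (1 + ‖u₀‖ + n * ‖c‖) / ‖c‖ with hK
  have hc0 : 0 < ‖c‖ := norm_pos_iff.mpr hc
  have hK0 : 0 ≤ K := by positivity
  have hbasis : ∀ m : Fin (n + 1),
      pwnorm (normRingSeminorm ℂ) (Lagrange.basis Finset.univ v m) ≤ K ^ n := by
    intro m
    unfold Lagrange.basis
    refine (pwnorm_prod_le _ (by change ‖(1 : ℂ)‖ ≤ 1; rw [norm_one]) _ _).trans ?_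
    have hcard : (Finset.univ.erase m).card = n := by
      rw [Finset.card_erase_of_mem (Finset.mem_univ m), Finset.card_univ, Fintype.card_fin]
      rfl
    refine le_trans ?_ (le_of_eq (by rw [Finset.prod_const, hcard] :
      ∏ _m' ∈ Finset.univ.erase m, K = K ^ n))
    refine Finset.prod_le_prod (fun m' _ => pwnorm_nonneg _ _) fun m' hm' => ?_
    have hne : m' ≠ m := Finset.ne_of_mem_erase hm'
    refine (pwnorm_basisDivisor_le _ _).trans ?_
    -- `|v m - v m'| ≥ |c|` and `|v m'| ≤ |u₀| + n |c|`
    have hdiff : ‖c‖ ≤ ‖v m - v m'‖ := by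
      have : v m - v m' = ((m : ℕ) - (m' : ℕ) : ℂ) * c := by simp only [hv]; ring
      rw [this, norm_mul]
      have h1 : (1 : ℝ) ≤ ‖((m : ℕ) - (m' : ℕ) : ℂ)‖ := by
        have : ((m : ℕ) - (m' : ℕ) : ℂ) = ((m : ℤ) - (m' : ℤ) : ℤ) := by push_cast; ring
        rw [this, Complex.norm_intCast]
        have hne' : ((m : ℕ) : ℤ) ≠ (m' : ℕ) := by
          intro h; exact hne (Fin.ext (by exact_mod_cast h.symm))
        have : (1 : ℤ) ≤ |((m : ℕ) : ℤ) - (m' : ℕ)| := Int.one_le_abs (sub_ne_zero.mpr hne')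
        exact_mod_cast this
      nlinarith
    have hvm' : ‖v m'‖ ≤ ‖u₀‖ + n * ‖c‖ := by
      simp only [hv]
      refine (norm_add_le _ _).trans ?_
      rw [norm_mul, Complex.norm_natCast]
      gcongr
      exact_mod_cast Nat.lt_succ_iff.mp m'.2
    rw [norm_inv, hK, div_eq_inv_mul]
    exact mul_le_mul (inv_anti₀ hc0 hdiff) (by linarith) (by positivity) (by positivity)
  -- assemble
  have hν1 : ∀ m : Fin (n + 1), ‖q.eval (v m)‖ ≤ V := fun m => by
    rw [hqeval]; exact h m (Nat.lt_succ_iff.mp m.2)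
  calc ‖a j‖ = ‖q.coeff j‖ := by rw [hcoeff]
    _ ≤ pwnorm (normRingSeminorm ℂ) q := le_pwnorm (normRingSeminorm ℂ) q j
    _ = pwnorm (normRingSeminorm ℂ)
          (∑ m, C (q.eval (v m)) * Lagrange.basis Finset.univ v m) := by
        conv_lhs => rw [hinterp]
        rw [Lagrange.interpolate_apply]
    _ ≤ ∑ m, pwnorm (normRingSeminorm ℂ) (C (q.eval (v m)) * Lagrange.basis Finset.univ v m) :=
        pwnorm_sum_le _ _ _
    _ ≤ ∑ _m : Fin (n + 1), V * K ^ n := by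
        refine Finset.sum_le_sum fun m _ => (pwnorm_mul_le _ _ _).trans ?_
        rw [pwnorm_C]
        exact mul_le_mul (hν1 m) (hbasis m) (pwnorm_nonneg _ _) hV
    _ = (n + 1) * K ^ n * V := by
        rw [Finset.sum_const, Finset.card_univ, Fintype.card_fin, nsmul_eq_mul]
        push_cast
        ring

/-! ### The zero estimate -/

variable (L : PeriodPair)

/-- `(D+1) (c (D+1))^D ≤ exp((log c + 2)(D+1)²)` for `c ≥ 1`. [folklore] -/
lemma succ_mul_pow_le_exp {c : ℝ} (hc : 1 ≤ c) (D : ℕ) :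
    ((D : ℝ) + 1) * (c * (D + 1)) ^ D ≤ Real.exp ((Real.log c + 2) * ((D : ℝ) + 1) ^ 2) := by
  have hD1 : (1 : ℝ) ≤ (D : ℝ) + 1 := by
    have := (Nat.cast_nonneg D : (0 : ℝ) ≤ D); linarith
  have hcD : (0 : ℝ) < c * (D + 1) := by positivity
  have hlogc : 0 ≤ Real.log c := Real.log_nonneg hc
  calc ((D : ℝ) + 1) * (c * (D + 1)) ^ D ≤ (c * (D + 1)) * (c * (D + 1)) ^ D := by
        apply mul_le_mul_of_nonneg_right _ (by positivity)
        nlinarith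
    _ = (c * (D + 1)) ^ (D + 1) := by ring
    _ = Real.exp (((D + 1 : ℕ) : ℝ) * Real.log (c * (D + 1))) := by
        rw [Real.exp_nat_mul, Real.exp_log hcD]
    _ ≤ Real.exp ((Real.log c + 2) * ((D : ℝ) + 1) ^ 2) := by
        apply Real.exp_le_exp.mpr
        rw [Real.log_mul (by positivity) (by positivity)]
        have hlogD : Real.log ((D : ℝ) + 1) ≤ (D : ℝ) + 1 := Real.log_le_self (by positivity)
        have h1 : ((D : ℝ) + 1) * Real.log ((D : ℝ) + 1) ≤ ((D : ℝ) + 1) ^ 2 := by nlinarith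
        have h2 : ((D : ℝ) + 1) * Real.log c ≤ Real.log c * ((D : ℝ) + 1) ^ 2 := by
          have h3 : (D : ℝ) + 1 ≤ ((D : ℝ) + 1) ^ 2 := by nlinarith
          have := mul_le_mul_of_nonneg_left h3 hlogc
          linarith
        push_cast
        nlinarith

/-- `(1 + A + D t)/t ≤ ((2 + A + t)/t) (D+1)` for `A ≥ 0`, `t > 0`. [folklore] -/
lemma ratio_le_mul_succ {A t : ℝ} (hA : 0 ≤ A) (ht : 0 < t) (D : ℕ) :
    (1 + A + D * t) / t ≤ (2 + A + t) / t * ((D : ℝ) + 1) := by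
  rw [div_mul_eq_mul_div, div_le_div_iff_of_pos_right ht]
  have hD : (0 : ℝ) ≤ D := Nat.cast_nonneg D
  nlinarith

/-- `(1 + A + D h)/h ≤ ((2 + A + ρ)/ρ) (D+1)` for `h = ρ/(D+1)`. [folklore] -/
lemma ratio_le_mul_succ' {A ρ : ℝ} (hA : 0 ≤ A) (hρ : 0 < ρ) (D : ℕ) :
    (1 + A + D * (ρ / (D + 1))) / (ρ / (D + 1)) ≤ (2 + A + ρ) / ρ * ((D : ℝ) + 1) := by
  have hD : (0 : ℝ) ≤ D := Nat.cast_nonneg D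
  have hD1 : (0 : ℝ) < D + 1 := by linarith
  have hDh : (D : ℝ) * (ρ / (D + 1)) ≤ ρ := by
    rw [mul_div_assoc', div_le_iff₀ hD1]; nlinarith
  rw [div_le_iff₀ (by positivity)]
  have : (2 + A + ρ) / ρ * ((D : ℝ) + 1) * (ρ / (D + 1)) = 2 + A + ρ := by
    field_simp
  rw [this]
  linarith

/-- **The double interpolation.** If `‖F_p(z + mω₂)‖ ≤ V` for all `z` in the disc
`B = closedBall (ω₁/2) δ` and `m ≤ D`, where `℘(B) ⊇ ball (e₁, ρ)` and `|g| ≤ B_g` on `B`, then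
every coefficient satisfies `‖p_{ik}‖ ≤ K₂ K₁ V` with
`K₁ = (D+1)((1 + B_g + D|c|)/|c|)^D`, `K₂ = (D+1)((1 + |e₁| + Dh)/h)^D`, `h = ρ/(D+1)`
(interpolate first in `u = g(z) + mc`, then in `y = ℘(z) = e₁ + rh`).
[cite: Chudnovsky1984, Ch. 7 Lemma 3.2 p. 310] -/
theorem coeff_le_of_translates_small {δ ρ Bg V : ℝ} (hρ : 0 < ρ)
    (himage : ball (e₁ L) ρ ⊆ ℘[L] '' closedBall (L.ω₁ / 2) δ)
    (hBg : ∀ z ∈ closedBall (L.ω₁ / 2) δ, ‖g L z‖ ≤ Bg) (hBg0 : 0 ≤ Bg) (hV : 0 ≤ V)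
    {D : ℕ} (p : Fin (D + 1) × Fin (D + 1) → ℂ)
    (hsm : ∀ z ∈ closedBall (L.ω₁ / 2) δ, ∀ m : ℕ, m ≤ D → ‖F L D p (z + m * L.ω₂)‖ ≤ V)
    (l : Fin (D + 1) × Fin (D + 1)) :
    ‖p l‖ ≤ ((D + 1) * ((1 + ‖e₁ L‖ + D * (ρ / (D + 1))) / (ρ / (D + 1))) ^ D) *
      (((D + 1) * ((1 + Bg + D * ‖c L‖) / ‖c L‖) ^ D) * V) := by
  have hD0 : (0 : ℝ) ≤ D := Nat.cast_nonneg D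
  set K₁ : ℝ := (D + 1) * ((1 + Bg + D * ‖c L‖) / ‖c L‖) ^ D with hK₁
  -- Step 1: interpolation in the variable `u = g(z) + mc`
  have hstep1 : ∀ z ∈ closedBall (L.ω₁ / 2) δ, ∀ i : Fin (D + 1),
      ‖∑ k : Fin (D + 1), p (i, k) * ℘[L] z ^ (k : ℕ)‖ ≤ K₁ * V := by
    intro z hz i
    set a : Fin (D + 1) → ℂ := fun i => ∑ k : Fin (D + 1), p (i, k) * ℘[L] z ^ (k : ℕ) with ha
    have hval : ∀ m : ℕ, m ≤ D →
        ‖∑ i : Fin (D + 1), a i * (g L z + m * c L) ^ (i : ℕ)‖ ≤ V := by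
      intro m hm
      have hFm := hsm z hz m hm
      rw [F_add_nat_mul_ω₂] at hFm
      have heq : ∑ i : Fin (D + 1), a i * (g L z + m * c L) ^ (i : ℕ) =
          ∑ l : Fin (D + 1) × Fin (D + 1),
            p l * ((g L z + m * c L) ^ (l.1 : ℕ) * ℘[L] z ^ (l.2 : ℕ)) := by
        rw [Fintype.sum_prod_type]
        refine Finset.sum_congr rfl fun i _ => ?_
        simp only [ha, Finset.sum_mul]
        refine Finset.sum_congr rfl fun k _ => ?_
        ring
      rw [heq]
      exact hFm
    have hb := interpolation_bound D a (g L z) (c L) (c_ne_zero L) hV hval i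
    refine hb.trans ?_
    rw [hK₁]
    have hgz : ‖g L z‖ ≤ Bg := hBg z hz
    have hcL : 0 < ‖c L‖ := norm_pos_iff.mpr (c_ne_zero L)
    gcongr
  -- Step 2: interpolation in `y = ℘(z)` at the nodes `e₁ + r h`, `h = ρ/(D+1)`
  set h : ℝ := ρ / (D + 1) with hh
  have hh0 : 0 < h := by positivity
  have hnodes : ∀ r : ℕ, r ≤ D → ∃ z ∈ closedBall (L.ω₁ / 2) δ, ℘[L] z = e₁ L + r * (h : ℂ) := by
    intro r hr
    have hmem : e₁ L + r * (h : ℂ) ∈ ball (e₁ L) ρ := by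
      rw [mem_ball, dist_eq_norm, add_sub_cancel_left, norm_mul, Complex.norm_natCast,
        Complex.norm_real, Real.norm_eq_abs, abs_of_pos hh0, hh]
      have hr' : (r : ℝ) ≤ D := by exact_mod_cast hr
      have hD1 : (0 : ℝ) < D + 1 := by linarith
      calc (r : ℝ) * (ρ / (D + 1)) ≤ D * (ρ / (D + 1)) := by gcongr
        _ < (D + 1) * (ρ / (D + 1)) := by gcongr; linarith
        _ = ρ := by field_simp
    obtain ⟨z, hz, hzy⟩ := himage hmem
    exact ⟨z, hz, hzy⟩
  obtain ⟨i, k⟩ := l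
  have hval : ∀ r : ℕ, r ≤ D →
      ‖∑ k : Fin (D + 1), p (i, k) * (e₁ L + r * (h : ℂ)) ^ (k : ℕ)‖ ≤ K₁ * V := by
    intro r hr
    obtain ⟨z, hz, hzy⟩ := hnodes r hr
    rw [← hzy]
    exact hstep1 z hz i
  have hK₁0 : 0 ≤ K₁ := by
    have hcL : 0 < ‖c L‖ := norm_pos_iff.mpr (c_ne_zero L)
    positivity
  have hb := interpolation_bound D (fun k => p (i, k)) (e₁ L) (h : ℂ)
    (by exact_mod_cast hh0.ne') (by positivity) hval k
  refine hb.trans (le_of_eq ?_)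
  rw [Complex.norm_real, Real.norm_eq_abs, abs_of_pos hh0]

/-- **Zero estimate** (elementary substitute for Chudnovsky 1984, Ch. 7, Lemma 3.2, p. 310). There
is `C = C(Λ)` such that for every nonzero coefficient family `p` of bidegree `≤ (D, D)`: if
`F_p^{(j)}(s_m) = 0` for all `j < T` and `m < X` (`X ≥ 1`), then `T X² ≤ C (D+1) (X+D)²`.
[cite: Chudnovsky1984, Ch. 7 Lemma 3.2 p. 310] -/
theorem zero_estimate :
    ∃ C : ℝ, 0 ≤ C ∧ ∀ (D X T : ℕ), 1 ≤ X → ∀ p : Fin (D + 1) × Fin (D + 1) → ℂ, p ≠ 0 →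
      (∀ m < X, ∀ j < T, iteratedDeriv j (F L D p) (s L m) = 0) →
      (T : ℝ) * X ^ 2 ≤ C * (D + 1) * ((X : ℝ) + D) ^ 2 := by
  obtain ⟨δ, hδ, hδ1, hball, ⟨ρ, hρ, himage⟩, C₀, hC₀, hsmall⟩ := norm_F_translate_le_of_zeros L
  -- a bound for `g` on the disc `B`
  have hBc : IsCompact (closedBall (L.ω₁ / 2) δ) := isCompact_closedBall _ _
  have hgcont : ContinuousOn (g L) (closedBall (L.ω₁ / 2) δ) :=
    (differentiableOn_g L).continuousOn.mono hball
  obtain ⟨Bg, hBg⟩ := hBc.exists_bound_of_continuousOn hgcont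
  have hBg0 : 0 ≤ Bg := le_trans (norm_nonneg _) (hBg _ (mem_closedBall_self hδ.le))
  -- the constants
  have hcL : 0 < ‖c L‖ := norm_pos_iff.mpr (c_ne_zero L)
  set c₁ : ℝ := (2 + Bg + ‖c L‖) / ‖c L‖ with hc₁
  set c₂ : ℝ := (2 + ‖e₁ L‖ + ρ) / ρ with hc₂
  have hc₁1 : 1 ≤ c₁ := by
    rw [hc₁, le_div_iff₀ hcL]; nlinarith [norm_nonneg (c L)]
  have hc₂1 : 1 ≤ c₂ := by
    rw [hc₂, le_div_iff₀ hρ]; nlinarith [norm_nonneg (e₁ L)]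
  set C₁ : ℝ := Real.log c₁ + Real.log c₂ + 4 with hC₁
  have hC₁0 : 0 ≤ C₁ := by
    have := Real.log_nonneg hc₁1
    have := Real.log_nonneg hc₂1
    rw [hC₁]; linarith
  refine ⟨C₀ + C₁, by positivity, fun D X T hX p hp hF => ?_⟩
  have hX' : (1 : ℝ) ≤ X := by exact_mod_cast hX
  have hD0 : (0 : ℝ) ≤ D := Nat.cast_nonneg D
  set E : ℝ := Real.exp (C₀ * (D + 1) * ((X : ℝ) + D) ^ 2) * Real.exp (-(T * X ^ 2 : ℝ)) with hE
  have hE0 : 0 < E := by positivity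
  -- smallness on the translates, and the double interpolation
  have hsm : ∀ z ∈ closedBall (L.ω₁ / 2) δ, ∀ m : ℕ, m ≤ D →
      ‖F L D p (z + m * L.ω₂)‖ ≤ ‖p‖ * E := by
    intro z hz m hm
    have := hsmall D X T hX p hF D z hz m hm
    rw [hE, ← mul_assoc]
    exact this
  set K₁ : ℝ := (D + 1) * ((1 + Bg + D * ‖c L‖) / ‖c L‖) ^ D with hK₁
  set K₂ : ℝ := (D + 1) * ((1 + ‖e₁ L‖ + D * (ρ / (D + 1))) / (ρ / (D + 1))) ^ D with hK₂
  have hcoef : ∀ l, ‖p l‖ ≤ K₂ * (K₁ * (‖p‖ * E)) := fun l =>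
    coeff_le_of_translates_small L hρ himage hBg hBg0 (by positivity) p hsm l
  -- compare with `‖p‖`
  have hpn : ‖p‖ ≤ K₂ * K₁ * E * ‖p‖ := by
    refine (pi_norm_le_iff_of_nonneg (by positivity)).mpr fun l => ?_
    refine (hcoef l).trans (le_of_eq ?_)
    ring
  have hp0 : 0 < ‖p‖ := norm_pos_iff.mpr hp
  have h1 : 1 ≤ K₂ * K₁ * E := by
    by_contra hlt
    push Not at hlt
    have := mul_lt_mul_of_pos_right hlt hp0
    rw [one_mul] at this
    linarith
  -- `K₁ ≤ exp((log c₁ + 2)(D+1)²)`, `K₂ ≤ exp((log c₂ + 2)(D+1)²)`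
  have hK₁le : K₁ ≤ Real.exp ((Real.log c₁ + 2) * ((D : ℝ) + 1) ^ 2) := by
    have hbase : (1 + Bg + D * ‖c L‖) / ‖c L‖ ≤ c₁ * (D + 1) := ratio_le_mul_succ hBg0 hcL D
    have hbase0 : 0 ≤ (1 + Bg + D * ‖c L‖) / ‖c L‖ := by positivity
    calc K₁ ≤ (D + 1) * (c₁ * (D + 1)) ^ D := by rw [hK₁]; gcongr
      _ ≤ _ := succ_mul_pow_le_exp hc₁1 D
  have hK₂le : K₂ ≤ Real.exp ((Real.log c₂ + 2) * ((D : ℝ) + 1) ^ 2) := by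
    have hbase : (1 + ‖e₁ L‖ + D * (ρ / (D + 1))) / (ρ / (D + 1)) ≤ c₂ * (D + 1) :=
      ratio_le_mul_succ' (norm_nonneg _) hρ D
    have hbase0 : 0 ≤ (1 + ‖e₁ L‖ + D * (ρ / (D + 1))) / (ρ / (D + 1)) := by positivity
    calc K₂ ≤ (D + 1) * (c₂ * (D + 1)) ^ D := by rw [hK₂]; gcongr
      _ ≤ _ := succ_mul_pow_le_exp hc₂1 D
  -- `1 ≤ K₂ K₁ E ≤ exp Z`, hence `0 ≤ Z`
  set Z : ℝ := C₁ * ((D : ℝ) + 1) ^ 2 + C₀ * (D + 1) * ((X : ℝ) + D) ^ 2 - T * X ^ 2 with hZ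
  have hfinal : (1 : ℝ) ≤ Real.exp Z := by
    calc (1 : ℝ) ≤ K₂ * K₁ * E := h1
      _ ≤ Real.exp ((Real.log c₂ + 2) * ((D : ℝ) + 1) ^ 2) *
            Real.exp ((Real.log c₁ + 2) * ((D : ℝ) + 1) ^ 2) * E := by
          have hK₁0 : 0 ≤ K₁ := by positivity
          gcongr
      _ = Real.exp Z := by
          rw [hE, ← Real.exp_add, ← Real.exp_add, ← Real.exp_add, hZ, hC₁]
          congr 1; ring
  have h0 : 0 ≤ Z := Real.one_le_exp_iff.mp hfinal
  -- `(D+1)^2 ≤ (D+1)(X+D)^2` since `X ≥ 1`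
  have h2 : (D : ℝ) + 1 ≤ (X : ℝ) + D := by linarith
  have h3 : (D : ℝ) + 1 ≤ ((X : ℝ) + D) ^ 2 :=
    h2.trans (le_self_pow₀ (by linarith) two_ne_zero)
  have hsq : ((D : ℝ) + 1) ^ 2 ≤ (D + 1) * ((X : ℝ) + D) ^ 2 := by
    rw [sq]
    exact mul_le_mul_of_nonneg_left h3 (by linarith)
  have hC₁sq : C₁ * ((D : ℝ) + 1) ^ 2 ≤ C₁ * ((D + 1) * ((X : ℝ) + D) ^ 2) :=
    mul_le_mul_of_nonneg_left hsq hC₁0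
  rw [hZ] at h0
  have key : (T : ℝ) * X ^ 2 ≤
      C₁ * ((D + 1) * ((X : ℝ) + D) ^ 2) + C₀ * (D + 1) * ((X : ℝ) + D) ^ 2 := by linarith
  calc (T : ℝ) * X ^ 2 ≤ _ := key
    _ = (C₀ + C₁) * (D + 1) * ((X : ℝ) + D) ^ 2 := by ring

end Literature.NumberTheory.Transcendental.Chudnovsky

end
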